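import Summits.HodgeConjecture.HodgeConjecture.Theorems.PadicSemiregularLiftAnchorsAtGenericHodgeLocusPointsSmoothCutOutChart
import Literature.AlgebraicGeometry.Crystalline.BlochEsnaultKerzLifting
import Literature.AlgebraicGeometry.Motives.ReducedClosedSubschemeIso
import HarnessLib

/-!
# Smooth hypersurfaces of `ℙⁿ⁺¹` over a DOMAIN, II: smoothness, properness, existence
# (helper for `AnchorsAtGenericHodgeLocusPoints`, stmt-HodgeConjecture-13944)

Route `PadicSemiregularLift` of `HodgeConjecture`, item P2b, Fermat half (B2): the anchor `Xⁿₘ / W(𝔽̄_p)`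
is a hypersurface over a RING that must be a smooth proper model (`WittScheme.IsSmoothProperModel`).
Part I (`…SmoothCutOutChart.lean`) proved that each chart of the reduced cut-out `V₊(F)` of a
nonsingular form over a domain is smooth; this part glues them and packages the result, def-free,
over the carriers `Crystalline.projectiveSpaceOver` / `Motives.IsHypersurfaceCutOutBy`:

* `isReduced_subscheme_vanishingIdeal` — the reduced cut-out of any zero locus is reduced;
* `smoothOfRelativeDimension_subschemeι_projToSpec` — **projective Jacobian criterion over a domain**:
  for a nonsingular form `F` of degree `d ≥ 1` over a domain `O`, the reduced cut-out `V₊(F) → Spec O`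
  is smooth of relative dimension `n` (Hartshorne I Ex. 5.8, III Thm. 10.2);
* `smoothOfRelativeDimension_of_range_eq_zeroLocus` — so is ANY reduced closed `O`-subscheme of
  `ℙⁿ⁺¹_O` with support `V₊(F)` (uniqueness of the reduced induced structure, Hartshorne II 3.2.6);
* `isProper_of_isClosedImmersion` — closed `O`-subschemes of `ℙᴺ_O` are proper over `O`;
* `exists_reduced_cutOut`, `exists_smooth_proper_cutOut` — the reduced cut-out exists; for a
  nonsingular form of degree `≥ 1` over a domain it is a reduced `O`-scheme, smooth of relative
  dimension `n` and proper over `O`, with a closed `O`-immersion into `ℙⁿ⁺¹_O` onto `V₊(F)`.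

References: R. Hartshorne, *Algebraic Geometry* (1977), I Ex. 5.8, II Example 3.2.6, II Thm. 4.9,
III Thm. 10.2 [Hartshorne1977]; The Stacks project, Tag 056T [StacksProject].
-/

-- the summit-side namespace `Summit.HodgeConjecture.HodgeConjecture.…` (summit = sub-problem, D-0017)
-- repeats a component by design; the linter would flag every declaration.
set_option linter.dupNamespace false

noncomputable section

open CategoryTheory CategoryTheory.Limits AlgebraicGeometry TopologicalSpace MvPolynomial
  HomogeneousLocalization
open Literature.AlgebraicGeometry.Motives Literature.AlgebraicGeometry.Crystalline
open Literature.AlgebraicGeometry.Motives.ProjectiveSpace Literature.AlgebraicGeometry.Motives.ProjSubscheme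
  Literature.AlgebraicGeometry.Motives.SmoothHypersurface

universe u

namespace Summit.HodgeConjecture.HodgeConjecture.Theorems.AnchorsAtGenericHodgeLocusPoints

/-! ### The reduced cut-out is reduced -/

section Reduced

variable {O : Type u} [CommRing O]

/-- The reduced cut-out `V₊(S)` is reduced: its affine pieces (Mathlib `subschemeCover`) are spectra of
quotients by vanishing ideals, which are radical. [cite: Hartshorne1977, II Example 3.2.6] -/
theorem isReduced_subscheme_vanishingIdeal {N : ℕ}
    (Z : letI := MvPolynomial.gradedAlgebra (σ := Fin (N + 1)) (R := O)
      Closeds (Proj (homogeneousSubmodule (Fin (N + 1)) O))) :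
    letI := MvPolynomial.gradedAlgebra (σ := Fin (N + 1)) (R := O)
    IsReduced (Scheme.IdealSheafData.vanishingIdeal Z).subscheme := by
  letI := MvPolynomial.gradedAlgebra (σ := Fin (N + 1)) (R := O)
  haveI : ∀ V, IsReduced ((Scheme.IdealSheafData.vanishingIdeal Z).subschemeCover.openCover.X V) := by
    intro (V : (Proj (homogeneousSubmodule (Fin (N + 1)) O)).affineOpens)
    change IsReduced (Spec (.of (Γ(Proj (homogeneousSubmodule (Fin (N + 1)) O),
      (V : (Proj _).Opens)) ⧸ (Scheme.IdealSheafData.vanishingIdeal Z).ideal V)))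
    haveI : _root_.IsReduced
        (Γ(Proj (homogeneousSubmodule (Fin (N + 1)) O), (V : (Proj _).Opens)) ⧸
          (Scheme.IdealSheafData.vanishingIdeal Z).ideal V) := by
      refine (Ideal.isRadical_iff_quotient_reduced _).mp ?_
      rw [Scheme.IdealSheafData.vanishingIdeal_ideal]
      exact PrimeSpectrum.isRadical_vanishingIdeal _
    infer_instance
  exact IsReduced.of_openCover _ (Scheme.IdealSheafData.vanishingIdeal Z).subschemeCover.openCover

end Reduced

/-! ### Smoothness of the reduced cut-out, and of any reduced cut-out with the same support -/

section Smooth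

variable {O : Type u} [CommRing O] [IsDomain O] {n : ℕ} (F : MvPolynomial (Fin (n + 2)) O) {d : ℕ}
  (hF : F.IsHomogeneous d)

include hF in
/-- **Projective Jacobian criterion over a domain** (Hartshorne I Ex. 5.8, III Thm. 10.2): for a
nonsingular form `F` of degree `d ≥ 1` over a domain `O`, the reduced cut-out `V₊(F) → Spec O` is
smooth of relative dimension `n` (Zariski-locally on the source, via the standard smooth charts over
the cover `D₊(xᵢ ∂ⱼF)` of part I). [cite: Hartshorne1977, I Ex. 5.8 and III Thm. 10.2] -/
theorem smoothOfRelativeDimension_subschemeι_projToSpec (hJ : IsNonsingularForm O F) (hd : 0 < d) :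
    letI := MvPolynomial.gradedAlgebra (σ := Fin (n + 2)) (R := O)
    SmoothOfRelativeDimension n
      ((Scheme.IdealSheafData.vanishingIdeal
                      (⟨ProjectiveSpectrum.zeroLocus (homogeneousSubmodule (Fin (n + 2)) O) {F},
                        ProjectiveSpectrum.isClosed_zeroLocus _ _⟩ :
                        Closeds (Proj (homogeneousSubmodule (Fin (n + 2)) O)))).subschemeι ≫
        ProjBaseChangeRing.projToSpec (Fin (n + 2)) O) := by
  letI := MvPolynomial.gradedAlgebra (σ := Fin (n + 2)) (R := O)
  have hxh : ∀ ij : Fin (n + 2) × Fin (n + 1), X ij.1 * pderiv (ij.1.succAbove ij.2) F ∈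
      homogeneousSubmodule (Fin (n + 2)) O (1 + (d - 1)) := fun ij =>
    SetLike.mul_mem_graded (X_mem ij.1) hF.pderiv
  have hrange :
      Set.range
          (Scheme.IdealSheafData.vanishingIdeal
                      (⟨ProjectiveSpectrum.zeroLocus (homogeneousSubmodule (Fin (n + 2)) O) {F},
                        ProjectiveSpectrum.isClosed_zeroLocus _ _⟩ :
                        Closeds (Proj (homogeneousSubmodule (Fin (n + 2)) O)))).subschemeι =
        ProjectiveSpectrum.zeroLocus (homogeneousSubmodule (Fin (n + 2)) O) {F} := by
    rw [Scheme.IdealSheafData.range_subschemeι, Scheme.IdealSheafData.coe_support_vanishingIdeal]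
    rfl
  let 𝒱 :
      (Scheme.IdealSheafData.vanishingIdeal
                      (⟨ProjectiveSpectrum.zeroLocus (homogeneousSubmodule (Fin (n + 2)) O) {F},
                        ProjectiveSpectrum.isClosed_zeroLocus _ _⟩ :
                        Closeds (Proj (homogeneousSubmodule (Fin (n + 2)) O)))).subscheme.OpenCover :=
    Scheme.Cover.mkOfCovers (Fin (n + 2) × Fin (n + 1))
      (fun ij => Spec (CommRingCat.of (Γ(Proj (homogeneousSubmodule (Fin (n + 2)) O),
        (affineBasicOpen (homogeneousSubmodule (Fin (n + 2)) O) _ (hxh ij)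
          (SmoothHypersurface.one_add_pos d) : (Proj (homogeneousSubmodule (Fin (n + 2)) O)).Opens)) ⧸
        (Scheme.IdealSheafData.vanishingIdeal
                      (⟨ProjectiveSpectrum.zeroLocus (homogeneousSubmodule (Fin (n + 2)) O) {F},
                        ProjectiveSpectrum.isClosed_zeroLocus _ _⟩ :
                        Closeds (Proj (homogeneousSubmodule (Fin (n + 2)) O)))).ideal
          (affineBasicOpen (homogeneousSubmodule (Fin (n + 2)) O) _ (hxh ij)
            (SmoothHypersurface.one_add_pos d)))))
      (fun ij => subschemePiece
        (Scheme.IdealSheafData.vanishingIdeal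
                      (⟨ProjectiveSpectrum.zeroLocus (homogeneousSubmodule (Fin (n + 2)) O) {F},
                        ProjectiveSpectrum.isClosed_zeroLocus _ _⟩ :
                        Closeds (Proj (homogeneousSubmodule (Fin (n + 2)) O))))
        (affineBasicOpen (homogeneousSubmodule (Fin (n + 2)) O) _ (hxh ij)
          (SmoothHypersurface.one_add_pos d)))
      (fun x => by
        obtain ⟨ij, hij⟩ := exists_mem_basicOpen_of_mem_zeroLocus F hF hJ
          ((Scheme.IdealSheafData.vanishingIdeal
                      (⟨ProjectiveSpectrum.zeroLocus (homogeneousSubmodule (Fin (n + 2)) O) {F},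
                        ProjectiveSpectrum.isClosed_zeroLocus _ _⟩ :
                        Closeds (Proj (homogeneousSubmodule (Fin (n + 2)) O)))).subschemeι x)
          (by
            have hx :
                (Scheme.IdealSheafData.vanishingIdeal
                      (⟨ProjectiveSpectrum.zeroLocus (homogeneousSubmodule (Fin (n + 2)) O) {F},
                        ProjectiveSpectrum.isClosed_zeroLocus _ _⟩ :
                        Closeds (Proj (homogeneousSubmodule (Fin (n + 2)) O)))).subschemeι x ∈
                  Set.range
                    (Scheme.IdealSheafData.vanishingIdeal
                      (⟨ProjectiveSpectrum.zeroLocus (homogeneousSubmodule (Fin (n + 2)) O) {F},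
                        ProjectiveSpectrum.isClosed_zeroLocus _ _⟩ :
                        Closeds (Proj (homogeneousSubmodule (Fin (n + 2)) O)))).subschemeι := ⟨x, rfl⟩
            rw [hrange] at hx
            exact hx)
        have hx : x ∈ (subschemePiece
            (Scheme.IdealSheafData.vanishingIdeal
                      (⟨ProjectiveSpectrum.zeroLocus (homogeneousSubmodule (Fin (n + 2)) O) {F},
                        ProjectiveSpectrum.isClosed_zeroLocus _ _⟩ :
                        Closeds (Proj (homogeneousSubmodule (Fin (n + 2)) O))))
            (affineBasicOpen (homogeneousSubmodule (Fin (n + 2)) O) _ (hxh ij)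
              (SmoothHypersurface.one_add_pos d))).opensRange := by
          rw [opensRange_subschemePiece]
          exact hij
        obtain ⟨y, hy⟩ := hx
        exact ⟨ij, y, hy⟩)
  exact IsZariskiLocalAtSource.of_openCover (P := @SmoothOfRelativeDimension n) 𝒱 fun ij =>
    smoothOfRelativeDimension_subschemePiece F hF ij.1 ij.2 hd

include hF in
/-- **Any reduced closed `O`-subscheme of `ℙⁿ⁺¹_O` with support `V₊(F)` is smooth of relative
dimension `n` over the domain `O`** (`F` nonsingular of degree `d ≥ 1`): it is isomorphic over `ℙⁿ⁺¹_O`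
to the reduced cut-out (uniqueness of the reduced induced structure, Hartshorne II Example 3.2.6,
`Motives.exists_iso_of_isClosedImmersion_of_range_eq`). [cite: Hartshorne1977, II Example 3.2.6 and III Thm. 10.2] -/
theorem smoothOfRelativeDimension_of_range_eq_zeroLocus (hJ : IsNonsingularForm O F) (hd : 0 < d)
    (X : SchemeOver O) (ι : X ⟶ projectiveSpaceOver (n + 1) O) [IsClosedImmersion ι.left]
    [IsReduced X.left]
    (hrange : letI := MvPolynomial.gradedAlgebra (σ := Fin (n + 2)) (R := O)
      Set.range ι.left.base = ProjectiveSpectrum.zeroLocus (homogeneousSubmodule (Fin (n + 2)) O) {F}) :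
    SmoothOfRelativeDimension n X.hom := by
  letI := MvPolynomial.gradedAlgebra (σ := Fin (n + 2)) (R := O)
  have hrangeI :
      Set.range
          (Scheme.IdealSheafData.vanishingIdeal
                      (⟨ProjectiveSpectrum.zeroLocus (homogeneousSubmodule (Fin (n + 2)) O) {F},
                        ProjectiveSpectrum.isClosed_zeroLocus _ _⟩ :
                        Closeds (Proj (homogeneousSubmodule (Fin (n + 2)) O)))).subschemeι.base =
        ProjectiveSpectrum.zeroLocus (homogeneousSubmodule (Fin (n + 2)) O) {F} := by
    rw [Scheme.IdealSheafData.range_subschemeι, Scheme.IdealSheafData.coe_support_vanishingIdeal]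
    rfl
  haveI : IsReduced
      (Scheme.IdealSheafData.vanishingIdeal
                      (⟨ProjectiveSpectrum.zeroLocus (homogeneousSubmodule (Fin (n + 2)) O) {F},
                        ProjectiveSpectrum.isClosed_zeroLocus _ _⟩ :
                        Closeds (Proj (homogeneousSubmodule (Fin (n + 2)) O)))).subscheme :=
    isReduced_subscheme_vanishingIdeal (N := n + 1) _
  -- `X ≅ V₊(F)_red` over `ℙⁿ⁺¹_O`
  let ι' : X.left ⟶ Proj (homogeneousSubmodule (Fin (n + 2)) O) := ι.left
  haveI : IsClosedImmersion ι' := ‹IsClosedImmersion ι.left›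
  obtain ⟨e, he⟩ := exists_iso_of_isClosedImmersion_of_range_eq
    (Scheme.IdealSheafData.vanishingIdeal
                      (⟨ProjectiveSpectrum.zeroLocus (homogeneousSubmodule (Fin (n + 2)) O) {F},
                        ProjectiveSpectrum.isClosed_zeroLocus _ _⟩ :
                        Closeds (Proj (homogeneousSubmodule (Fin (n + 2)) O)))).subschemeι
    ι' (hrangeI.trans hrange.symm)
  have hX : X.hom = e.hom ≫
      (Scheme.IdealSheafData.vanishingIdeal
                      (⟨ProjectiveSpectrum.zeroLocus (homogeneousSubmodule (Fin (n + 2)) O) {F},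
                        ProjectiveSpectrum.isClosed_zeroLocus _ _⟩ :
                        Closeds (Proj (homogeneousSubmodule (Fin (n + 2)) O)))).subschemeι ≫
        ProjBaseChangeRing.projToSpec (Fin (n + 2)) O := by
    rw [← Category.assoc, he]
    exact (Over.w ι).symm
  rw [hX]
  exact (MorphismProperty.cancel_left_of_respectsIso (@SmoothOfRelativeDimension n) e.hom _).mpr
    (smoothOfRelativeDimension_subschemeι_projToSpec F hF hJ hd)

end Smooth

/-! ### Properness; existence of the reduced cut-out; the package -/

section Package

variable {O : Type u} [CommRing O]

/-- **Closed subschemes of `ℙᴺ_O` are proper over `O`**: a closed immersion is proper and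
`ℙᴺ_O → Spec O` is proper over any ring (`ProjBaseChangeRing.isProper_projToSpec`; Hartshorne II
Thm. 4.9). [cite: Hartshorne1977, II Thm. 4.9] -/
theorem isProper_of_isClosedImmersion {N : ℕ} (X : SchemeOver O) (ι : X ⟶ projectiveSpaceOver N O)
    [IsClosedImmersion ι.left] : IsProper X.hom := by
  rw [← Over.w ι]
  haveI : IsProper (projectiveSpaceOver N O).hom := ProjBaseChangeRing.isProper_projToSpec (Fin (N + 1)) O
  infer_instance

/-- **The reduced cut-out exists**: for every set `S ⊆ O[x₀, …, x_N]` there is a REDUCED `O`-scheme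
with a closed `O`-immersion into `ℙᴺ_O` onto `V₊(S)` (the reduced induced structure, Mathlib
`Scheme.IdealSheafData.vanishingIdeal`). [cite: Hartshorne1977, II Example 3.2.6] -/
theorem exists_reduced_cutOut {N : ℕ} (S : Set (MvPolynomial (Fin (N + 1)) O)) :
    letI := MvPolynomial.gradedAlgebra (σ := Fin (N + 1)) (R := O)
    ∃ (X : SchemeOver O) (ι : X ⟶ projectiveSpaceOver N O), IsClosedImmersion ι.left ∧
      IsReduced X.left ∧
      Set.range ι.left.base =
        ProjectiveSpectrum.zeroLocus (homogeneousSubmodule (Fin (N + 1)) O) S := by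
  letI := MvPolynomial.gradedAlgebra (σ := Fin (N + 1)) (R := O)
  let Z : Closeds (Proj (homogeneousSubmodule (Fin (N + 1)) O)) :=
    ⟨ProjectiveSpectrum.zeroLocus _ S, ProjectiveSpectrum.isClosed_zeroLocus _ S⟩
  let I := Scheme.IdealSheafData.vanishingIdeal Z
  haveI : IsReduced I.subscheme := isReduced_subscheme_vanishingIdeal (N := N) Z
  refine ⟨Over.mk (I.subschemeι ≫ (projectiveSpaceOver N O).hom), Over.homMk I.subschemeι rfl,
    inferInstanceAs (IsClosedImmersion I.subschemeι), ‹IsReduced I.subscheme›, ?_⟩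
  change Set.range I.subschemeι = _
  rw [Scheme.IdealSheafData.range_subschemeι, Scheme.IdealSheafData.coe_support_vanishingIdeal]
  rfl

/-- **The package: a smooth proper reduced cut-out of a nonsingular form over a domain.** For a
nonsingular form `F` of degree `d ≥ 1` in `n + 2` variables over a domain `O` there is a reduced
`O`-scheme `X`, smooth of relative dimension `n` and proper over `O`, with a closed `O`-immersion
into `ℙⁿ⁺¹_O` whose image is `V₊(F)`. [cite: Hartshorne1977, I Ex. 5.8, II Thm. 4.9 and III Thm. 10.2] -/
theorem exists_smooth_proper_cutOut [IsDomain O] {n d : ℕ} (F : MvPolynomial (Fin (n + 2)) O)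
    (hF : F.IsHomogeneous d) (hJ : IsNonsingularForm O F) (hd : 0 < d) :
    letI := MvPolynomial.gradedAlgebra (σ := Fin (n + 2)) (R := O)
    ∃ (X : SchemeOver O) (ι : X ⟶ projectiveSpaceOver (n + 1) O), IsClosedImmersion ι.left ∧
      IsReduced X.left ∧ SmoothOfRelativeDimension n X.hom ∧ IsProper X.hom ∧
      Set.range ι.left.base =
        ProjectiveSpectrum.zeroLocus (homogeneousSubmodule (Fin (n + 2)) O) {F} := by
  obtain ⟨X, ι, hι, hred, hrange⟩ := exists_reduced_cutOut (N := n + 1) ({F} : Set _)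
  haveI := hι
  haveI := hred
  exact ⟨X, ι, hι, hred, smoothOfRelativeDimension_of_range_eq_zeroLocus F hF hJ hd X ι hrange,
    isProper_of_isClosedImmersion X ι, hrange⟩

end Package

end Summit.HodgeConjecture.HodgeConjecture.Theorems.AnchorsAtGenericHodgeLocusPoints

end
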